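import Summits.PneNP.PneNP.Theorems.NegLimitedDoorOfPlantedClique
import Summits.PneNP.PneNP.Theorems.NegLimitedDoorFlipProbLeSum
import HarnessLib

/-!
# Route NegLimited — door support `PlantedNegationTransfer` PROVED (line `correlation-door`; rung F-N1/p3, ROUND-8 §B.1)

Rossman's negation-limited transfer lemma (CCC 2015, Lemma 1.3 / 3.2) specialised to the planted-clique
coupling, as the §B item `PlantedNegationTransfer` (statement verbatim in `NegLimitedDoorOfPlantedClique.lean`):
a De Morgan circuit with `≤ t` NOT gates computing `CLIQUE(m, k)` (`k ≤ m`) yields one function `g`,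
constant or computed by a monotone circuit with no more gates, such that
`Pr_{G(m,½)}[no k-clique] ≤ (2^(t+1) − 1) · plantFlipProb m k ½ g`.

Proof = the planner's PROVED composition `PlantedNegationTransfer_of` of the registered skeleton
`correlation-door` (HOME/pnp-ideate-p3/r9/Skeleton-R9-door.lean; planted pairs are monotone jumps of `C`
via `cliqueFn_plantClique`, `plantFlipProb_cliqueFn` = the clique-free mass, max member via
`exists_max_image`, empty-cover case), applied to the two LANDED stubs `stub_amCoverMonPairs`
(`NegLimitedDoorAMCover.lean`) and `stub_flipProbLeSum` (`NegLimitedDoorFlipProbLeSum.lean`).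
With this file the door reduces to `QuartCliqueSlicesNP` (stub 4, plumbing) and the OPEN crux
`PlantedCliqueMonotoneAdvantageQuart` (via the landed glue `stub_doorOfPlantedClique`).
-/

set_option linter.dupNamespace false -- `Summit.PneNP.PneNP.…`: summit = sub-problem name (D-0017 single-conjunct layout)

namespace Summit.PneNP.PneNP.Theorems.NegLimitedDoor

open Finset
open Literature.Computability.Complexity

/-- List sums are bounded by length times a uniform bound (planner's helper). -/
theorem sum_map_le_length_mul {α : Type*} (L : List α) (φ : α → ℝ) (M : ℝ)
    (h : ∀ a ∈ L, φ a ≤ M) : (L.map φ).sum ≤ L.length * M := by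
  induction L with
  | nil => simp
  | cons a L ih =>
    simp only [List.map_cons, List.sum_cons, List.length_cons, Nat.cast_succ]
    have h1 : φ a ≤ M := h a (by simp)
    have h2 : (L.map φ).sum ≤ L.length * M := ih fun b hb => h b (by simp [hb])
    linarith

/-- Planting a clique only switches edges on: `x ≤ x ∪ K_A`. -/
theorem le_plantClique {m : ℕ} (A : Finset (Fin m)) (x : ↥(⊤ : SimpleGraph (Fin m)).edgeSet → Bool) :
    x ≤ plantClique A x := fun e => by
  simp only [plantClique]
  exact Bool.left_le_or _ _

/-- **Composition (planner's, PROVED)**: the Amano–Maruoka cover and the union bound give Rossman's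
transfer lemma for the planted pair. -/
theorem PlantedNegationTransfer_of : AMCoverMonPairs → FlipProbLeSum → PlantedNegationTransfer := by
  intro hAM hFlip m k t C hk hC hcomp ht
  classical
  obtain ⟨L, hlen, hmem, hcov⟩ := hAM _ C t hC ht
  -- every planted flip of `cliqueFn` is a jump of `C`, hence of a member of `L`
  have hcover : ∀ A ∈ powersetCard k (univ : Finset (Fin m)), ∀ x,
      cliqueFn m k x ≠ cliqueFn m k (plantClique A x) →
        ∃ g ∈ L, g x ≠ g (plantClique A x) := by
    intro A hA x hx
    have hAk : #A = k := (mem_powersetCard.1 hA).2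
    have htrue : cliqueFn m k (plantClique A x) = true := cliqueFn_plantClique (by omega) x
    have hfalse : cliqueFn m k x = false := by
      cases h : cliqueFn m k x
      · rfl
      · exact absurd (h.symm ▸ htrue ▸ rfl : cliqueFn m k x = cliqueFn m k (plantClique A x))
          (by rw [h, htrue] at hx ⊢; exact hx)
    obtain ⟨g, hg, hgx, hgy⟩ := hcov x (plantClique A x) (le_plantClique A x)
      (by rw [hcomp x, hfalse]) (by rw [hcomp, htrue])
    exact ⟨g, hg, by rw [hgx, hgy]; decide⟩
  have hsum : plantFlipProb m k (1 / 2) (cliqueFn m k) ≤ (L.map (plantFlipProb m k (1 / 2))).sum :=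
    hFlip m k (1 / 2) (by norm_num) (by norm_num) _ L hcover
  have hLHS : gnpProb m (1 / 2) (univ.filter fun x => cliqueFn m k x = false) =
      plantFlipProb m k (1 / 2) (cliqueFn m k) := by
    rw [plantFlipProb_cliqueFn hk]; rfl
  have hpow : (0 : ℝ) ≤ (2 : ℝ) ^ (t + 1) - 1 := by
    have : (1 : ℝ) ≤ (2 : ℝ) ^ (t + 1) := one_le_pow₀ (by norm_num)
    linarith
  have hlenR : (L.length : ℝ) ≤ (2 : ℝ) ^ (t + 1) - 1 := by
    have h1 : 1 ≤ 2 ^ (t + 1) := Nat.one_le_two_pow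
    have h2 : L.length + 1 ≤ 2 ^ (t + 1) := by omega
    have h3 : ((L.length + 1 : ℕ) : ℝ) ≤ ((2 ^ (t + 1) : ℕ) : ℝ) := by exact_mod_cast h2
    push_cast at h3
    linarith
  by_cases hL : L = []
  · -- empty cover: the clique-free mass is `0`; any constant works
    subst hL
    refine ⟨fun _ => false, Or.inl ⟨false, fun _ => rfl⟩, ?_⟩
    rw [hLHS]
    have h0 : plantFlipProb m k (1 / 2) (cliqueFn m k) ≤ 0 := by simpa using hsum
    have h1 : 0 ≤ plantFlipProb m k (1 / 2) (fun _ : (↥(⊤ : SimpleGraph (Fin m)).edgeSet → Bool) => false) :=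
      plantFlipProb_nonneg m k (by norm_num) (by norm_num) _
    nlinarith
  · -- the maximal member carries a `1/|L|` share
    have hne : L.toFinset.Nonempty := by
      obtain ⟨a, ha⟩ := List.exists_mem_of_ne_nil L hL
      exact ⟨a, List.mem_toFinset.2 ha⟩
    obtain ⟨a, ha, hmax⟩ := exists_max_image L.toFinset (plantFlipProb m k (1 / 2)) hne
    have haL : a ∈ L := List.mem_toFinset.1 ha
    refine ⟨a, hmem a haL, ?_⟩
    rw [hLHS]
    have hs : (L.map (plantFlipProb m k (1 / 2))).sum ≤ L.length * plantFlipProb m k (1 / 2) a :=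
      sum_map_le_length_mul L _ _ fun b hb => hmax b (List.mem_toFinset.2 hb)
    have ha0 : 0 ≤ plantFlipProb m k (1 / 2) a := plantFlipProb_nonneg m k (by norm_num) (by norm_num) _
    calc plantFlipProb m k (1 / 2) (cliqueFn m k)
        ≤ (L.map (plantFlipProb m k (1 / 2))).sum := hsum
      _ ≤ L.length * plantFlipProb m k (1 / 2) a := hs
      _ ≤ ((2 : ℝ) ^ (t + 1) - 1) * plantFlipProb m k (1 / 2) a :=
          mul_le_mul_of_nonneg_right hlenR ha0


/-- **`PlantedNegationTransfer` PROVED** from the landed stubs 1 and 2 of line `correlation-door`. -/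
theorem plantedNegationTransfer_holds : PlantedNegationTransfer :=
  PlantedNegationTransfer_of stub_amCoverMonPairs stub_flipProbLeSum

/-- The door modulo its two remaining inputs: the slice plumbing `QuartCliqueSlicesNP` (stub 4) and the
OPEN crux `PlantedCliqueMonotoneAdvantageQuart` imply `NeglimitedEpsLogNegationsR`. -/
theorem neglimitedEpsLogNegationsR_of (hSl : QuartCliqueSlicesNP) (hCrux : PlantedCliqueMonotoneAdvantageQuart) :
    Summit.PneNP.PneNP.Theses.NegLimited.NeglimitedEpsLogNegationsR :=
  stub_doorOfPlantedClique stub_amCoverMonPairs plantedNegationTransfer_holds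
    stub_plantedQuartCliqueNullMass hSl hCrux

end Summit.PneNP.PneNP.Theorems.NegLimitedDoor
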